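import Mathlib
import Literature.Probability.LatticeModels.GKSInequalities
import Summits.CriticalPhenomena.Ising3DConformalLimit.Theorems.PrecisionLaplacianInverseMFerromagnetPcovOfIm
import HarnessLib

/-!
# Crux `PrecisionLaplacian.InverseMFerromagnet` (stmt-CriticalPhenomena-4798), line `Sketch` —
# stub `helper_twoSum_precision` (core D structural: the precision matrix across a 2-separator)

THEOREM-ONLY file (no definitions).  Let `G = (⟨σ_pσ_q⟩)_{p,q}` be the spin second-moment matrix
of the zero-field pair ferromagnet `gksExpect univ K C` on `Fin n`, let `c₁ ≠ c₂ ∈ A`,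
`B := insert c₁ (insert c₂ Aᶜ)` and `S := {c₁, c₂} = A ∩ B` (a 2-separator), and assume the
Markov factorisation across `S` (proved separately as `helper_twoSep_markov`): for `x ∈ A`,
`y ∈ B`, `ρ := G_{c₁c₂}`,

  `(1 − ρ²) G_{xy} = (G_{yc₁} − ρ G_{yc₂}) G_{xc₁} + (G_{yc₂} − ρ G_{yc₁}) G_{xc₂}`.

We prove the decomposable-model formula for the precision matrix

  `G⁻¹ = [ (G_AA)⁻¹ ]⁰ + [ (G_BB)⁻¹ ]⁰ − [ (G_SS)⁻¹ ]⁰`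

(padded inverses of the three principal submatrices).

Proof (pure linear algebra; the only facts about `G` used besides the hypothesis are: `G` is
positive definite (`pcov_posDef_of_eq`), symmetric, with unit diagonal).  Since `G` is positive
definite, `1 − ρ² = det G_SS > 0` (`pcov_det_two_pos`), so with
`a_q := (G_{qc₁} − ρ G_{qc₂})/(1 − ρ²)`, `b_q := (G_{qc₂} − ρ G_{qc₁})/(1 − ρ²)` the hypothesis and
the symmetry of `G` give the factorisation `G_{rq} = G_{rc₁} a_q + G_{rc₂} b_q` whenever
`r ∈ A, q ∈ B` or `r ∈ B, q ∈ A` (`twoSum_factor`).  For each `T ∈ {A, B, S}` this holds for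
`r ∈ T`, `q ∉ T`, whence row `p` of `[ (G_TT)⁻¹ ]⁰ G` is `δ_{pq}` for `q ∈ T` and
`δ_{pc₁} a_q + δ_{pc₂} b_q` for `q ∉ T` (`twoSum_padded_mul`).  Summing the three contributions
with signs `+ + −` gives `δ_{pq}` in every case (`p, q ∈ A ∖ S`, `B ∖ S`, or `S`), i.e. `M G = 1`
for the right-hand side `M`, hence `G⁻¹ = M` (`Matrix.inv_eq_left_inv`).
-/

namespace Summit.CriticalPhenomena.Ising3DConformalLimit.Cruxes.InverseMFerromagnet.PartialCovarianceLadder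

open Literature.Probability.LatticeModels Finset Matrix

/-! ## Linear algebra -/

/-- **A padded inverse of a principal block times the full matrix, 2-separator version.** For `G`
positive definite, `c₁, c₂ ∈ T`, and the factorisation `G_rq = G_rc₁ a_q + G_rc₂ b_q` for `r ∈ T`,
`q ∉ T`: the row `p` of `[ (G_TT)⁻¹ ]⁰ G` is `δ_pq` for `q ∈ T` and `δ_pc₁ a_q + δ_pc₂ b_q` for
`q ∉ T` (and `0` if `p ∉ T`). [folklore] -/
theorem twoSum_padded_mul {n : ℕ} (G : Matrix (Fin n) (Fin n) ℝ) (hPD : G.PosDef)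
    (T : Finset (Fin n)) (c₁ c₂ : Fin n) (hc₁ : c₁ ∈ T) (hc₂ : c₂ ∈ T) (a b : Fin n → ℝ)
    (hfac : ∀ r ∈ T, ∀ q ∉ T, G r q = G r c₁ * a q + G r c₂ * b q) (p q : Fin n) :
    ∑ r, (if h : p ∈ T ∧ r ∈ T then
        (G.submatrix (Subtype.val : ↥T → Fin n) (Subtype.val : ↥T → Fin n))⁻¹ ⟨p, h.1⟩ ⟨r, h.2⟩
      else 0) * G r q
      = if p ∈ T then
          (if q ∈ T then (if p = q then 1 else 0)
            else (if p = c₁ then 1 else 0) * a q + (if p = c₂ then 1 else 0) * b q)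
        else 0 := by
  by_cases hp : p ∈ T
  · set X := G.submatrix (Subtype.val : ↥T → Fin n) (Subtype.val : ↥T → Fin n) with hX
    have hXX : X⁻¹ * X = 1 := Matrix.nonsing_inv_mul X
      ((Matrix.isUnit_iff_isUnit_det X).mp (hPD.submatrix Subtype.val_injective).isUnit)
    have hone : ∀ (z : Fin n) (hz : z ∈ T), ∑ r : ↥T, X⁻¹ ⟨p, hp⟩ r * G r.1 z
        = if p = z then 1 else 0 := by
      intro z hz
      have h := congrFun (congrFun hXX ⟨p, hp⟩) ⟨z, hz⟩
      rw [Matrix.mul_apply, Matrix.one_apply] at h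
      simp only [Subtype.mk.injEq] at h
      rw [← h]
      rfl
    have hsum : ∑ r, (if h : p ∈ T ∧ r ∈ T then X⁻¹ ⟨p, h.1⟩ ⟨r, h.2⟩ else 0) * G r q
        = ∑ r : ↥T, X⁻¹ ⟨p, hp⟩ r * G r.1 q := by
      have hterm : ∀ r, (if h : p ∈ T ∧ r ∈ T then X⁻¹ ⟨p, h.1⟩ ⟨r, h.2⟩ else 0) * G r q
          = if h : r ∈ T then X⁻¹ ⟨p, hp⟩ ⟨r, h⟩ * G r q else 0 := by
        intro r
        by_cases hr : r ∈ T
        · rw [dif_pos ⟨hp, hr⟩, dif_pos hr]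
        · rw [dif_neg (fun h => hr h.2), dif_neg hr, zero_mul]
      rw [Finset.sum_congr rfl (fun r _ => hterm r)]
      -- `∑_r (if r ∈ T then f r else 0) = ∑_{r : T} f r`
      have h1 : ∑ r : ↥T, X⁻¹ ⟨p, hp⟩ r * G r.1 q
          = ∑ r : ↥T, (fun i => if h : i ∈ T then X⁻¹ ⟨p, hp⟩ ⟨i, h⟩ * G i q else 0) r.1 :=
        Finset.sum_congr rfl fun r _ => by simp only [dif_pos r.2]
      rw [h1, Finset.sum_coe_sort T (fun i => if h : i ∈ T then X⁻¹ ⟨p, hp⟩ ⟨i, h⟩ * G i q else 0)]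
      exact (Finset.sum_subset (Finset.subset_univ T) fun r _ hr => dif_neg hr).symm
    rw [hsum, if_pos hp]
    by_cases hq : q ∈ T
    · rw [if_pos hq, hone q hq]
    · rw [if_neg hq, ← hone c₁ hc₁, ← hone c₂ hc₂, Finset.sum_mul, Finset.sum_mul,
        ← Finset.sum_add_distrib]
      refine Finset.sum_congr rfl fun r _ => ?_
      rw [hfac r.1 r.2 q hq]
      ring
  · rw [if_neg hp]
    exact Finset.sum_eq_zero fun r _ => by rw [dif_neg (fun h => hp h.1), zero_mul]

/-- **The factorisation through a 2-separator, solved form.** From the Markov identity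
`(1 − ρ²) G_xy = (G_yc₁ − ρ G_yc₂) G_xc₁ + (G_yc₂ − ρ G_yc₁) G_xc₂` (`x ∈ A`, `y ∈ B`), symmetry of
`G` and `1 − ρ² ≠ 0`: `G_rq = G_rc₁ a_q + G_rc₂ b_q` with `a_q = (G_qc₁ − ρ G_qc₂)/(1 − ρ²)`,
`b_q = (G_qc₂ − ρ G_qc₁)/(1 − ρ²)`, whenever `r ∈ A, q ∈ B` or `r ∈ B, q ∈ A`. [folklore] -/
theorem twoSum_factor {n : ℕ} (G : Matrix (Fin n) (Fin n) ℝ) (hsymm : ∀ p q, G p q = G q p)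
    (A B : Finset (Fin n)) (c₁ c₂ : Fin n) (hρ : 1 - G c₁ c₂ ^ 2 ≠ 0)
    (hM : ∀ x y : Fin n, x ∈ A → y ∈ B →
      (1 - G c₁ c₂ ^ 2) * G x y
        = (G y c₁ - G c₁ c₂ * G y c₂) * G x c₁ + (G y c₂ - G c₁ c₂ * G y c₁) * G x c₂)
    (r q : Fin n) (hrq : (r ∈ A ∧ q ∈ B) ∨ (r ∈ B ∧ q ∈ A)) :
    G r q = G r c₁ * ((G q c₁ - G c₁ c₂ * G q c₂) / (1 - G c₁ c₂ ^ 2))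
      + G r c₂ * ((G q c₂ - G c₁ c₂ * G q c₁) / (1 - G c₁ c₂ ^ 2)) := by
  rw [mul_div_assoc', mul_div_assoc', ← add_div, eq_div_iff hρ]
  rcases hrq with ⟨hr, hq⟩ | ⟨hr, hq⟩
  · linear_combination hM r q hr hq
  · rw [hsymm r q]
    linear_combination hM q r hq hr

/-! ## The registered stub -/

/-- Registered stub `helper_twoSum_precision` (core D structural fact of line `Sketch`): **the
precision matrix across a 2-separator (decomposable-model formula).**  If every bond of the
zero-field pair ferromagnet lies inside `A` or inside `B = insert c₁ (insert c₂ Aᶜ)`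
(`c₁ ≠ c₂ ∈ A`, `S = {c₁, c₂}` the separator) and the second-moment matrix `G = (⟨σ_pσ_q⟩)`
satisfies the Markov factorisation across `S`, then
`G⁻¹ = [ (G_AA)⁻¹ ]⁰ + [ (G_BB)⁻¹ ]⁰ − [ (G_SS)⁻¹ ]⁰`.  The right-hand side `M` satisfies `M G = 1`
(`twoSum_padded_mul` for `T = A, B, S` with the solved factorisation `twoSum_factor`, which needs
`1 − ρ² > 0` from positive definiteness, `pcov_det_two_pos`), and `G` is positive definite
(`pcov_posDef_of_eq`), so `G⁻¹ = M`. [folklore] -/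
theorem helper_twoSum_precision :
    ∀ (n m : ℕ) (K : Fin m → ℝ) (C : Fin m → Finset (Fin n)), (∀ i, 0 ≤ K i) → (∀ i, (C i).card = 2) →
      ∀ (c₁ c₂ : Fin n) (A : Finset (Fin n)), c₁ ≠ c₂ → c₁ ∈ A → c₂ ∈ A →
        (∀ i, C i ⊆ A ∨ C i ⊆ insert c₁ (insert c₂ Aᶜ)) →
        ∀ G : Matrix (Fin n) (Fin n) ℝ,
          G = Matrix.of (fun p q : Fin n => gksExpect Finset.univ K C (fun ω => spinAt p ω * spinAt q ω)) →
          (∀ x y : Fin n, x ∈ A → y ∈ insert c₁ (insert c₂ Aᶜ) →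
            (1 - G c₁ c₂ ^ 2) * G x y
              = (G y c₁ - G c₁ c₂ * G y c₂) * G x c₁ + (G y c₂ - G c₁ c₂ * G y c₁) * G x c₂) →
          ∀ p q : Fin n,
            G⁻¹ p q =
              (if h : p ∈ A ∧ q ∈ A then
                  (G.submatrix (Subtype.val : ↥A → Fin n) (Subtype.val : ↥A → Fin n))⁻¹ ⟨p, h.1⟩ ⟨q, h.2⟩
               else 0)
              + (if h : p ∈ insert c₁ (insert c₂ Aᶜ) ∧ q ∈ insert c₁ (insert c₂ Aᶜ) then
                  (G.submatrix (Subtype.val : ↥(insert c₁ (insert c₂ Aᶜ)) → Fin n)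
                      (Subtype.val : ↥(insert c₁ (insert c₂ Aᶜ)) → Fin n))⁻¹ ⟨p, h.1⟩ ⟨q, h.2⟩
               else 0)
              - (if h : p ∈ ({c₁, c₂} : Finset (Fin n)) ∧ q ∈ ({c₁, c₂} : Finset (Fin n)) then
                  (G.submatrix (Subtype.val : ↥({c₁, c₂} : Finset (Fin n)) → Fin n)
                      (Subtype.val : ↥({c₁, c₂} : Finset (Fin n)) → Fin n))⁻¹ ⟨p, h.1⟩ ⟨q, h.2⟩
               else 0) := by
  intro n m K C _ _ c₁ c₂ A hc hc₁ hc₂ _ G hG hMarkov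
  -- facts about `G`: positive definite, symmetric, unit diagonal, `1 - ρ² ≠ 0`
  have hPD : G.PosDef := pcov_posDef_of_eq hG
  have hsymm : ∀ p q, G p q = G q p := fun p q => by
    simp only [hG, Matrix.of_apply]
    exact congrArg _ (funext fun ω => mul_comm _ _)
  have hdiag : ∀ p, G p p = 1 := fun p => by
    simp only [hG, Matrix.of_apply, spinAt_mul_self]
    exact div_self (gksSum_one_pos _ K C).ne'
  have hρ : 1 - G c₁ c₂ ^ 2 ≠ 0 := by
    have h := pcov_det_two_pos hPD hc
    rw [hdiag, hdiag, hsymm c₂ c₁] at h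
    have e : 1 - G c₁ c₂ ^ 2 = 1 * 1 - G c₁ c₂ * G c₁ c₂ := by ring
    rw [e]
    exact h.ne'
  -- membership bookkeeping for `B = insert c₁ (insert c₂ Aᶜ)` and `S = {c₁, c₂}`
  have hmemB : ∀ z, z ∈ insert c₁ (insert c₂ Aᶜ) ↔ z = c₁ ∨ z = c₂ ∨ z ∉ A := fun z => by
    rw [Finset.mem_insert, Finset.mem_insert, Finset.mem_compl]
  have hmemS : ∀ z, z ∈ ({c₁, c₂} : Finset (Fin n)) ↔ z = c₁ ∨ z = c₂ := fun z => by
    rw [Finset.mem_insert, Finset.mem_singleton]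
  have hc₁B : c₁ ∈ insert c₁ (insert c₂ Aᶜ) := (hmemB c₁).2 (Or.inl rfl)
  have hc₂B : c₂ ∈ insert c₁ (insert c₂ Aᶜ) := (hmemB c₂).2 (Or.inr (Or.inl rfl))
  have hc₁S : c₁ ∈ ({c₁, c₂} : Finset (Fin n)) := (hmemS c₁).2 (Or.inl rfl)
  have hc₂S : c₂ ∈ ({c₁, c₂} : Finset (Fin n)) := (hmemS c₂).2 (Or.inr rfl)
  have hSA : ∀ z, z ∈ ({c₁, c₂} : Finset (Fin n)) → z ∈ A := fun z hz => by
    rcases (hmemS z).1 hz with rfl | rfl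
    · exact hc₁
    · exact hc₂
  have hSB : ∀ z, z ∈ ({c₁, c₂} : Finset (Fin n)) → z ∈ insert c₁ (insert c₂ Aᶜ) := fun z hz => by
    rcases (hmemS z).1 hz with rfl | rfl
    · exact hc₁B
    · exact hc₂B
  have hAB : ∀ z, z ∉ A → z ∈ insert c₁ (insert c₂ Aᶜ) := fun z hz => (hmemB z).2 (Or.inr (Or.inr hz))
  have hBA : ∀ z, z ∉ insert c₁ (insert c₂ Aᶜ) → z ∈ A := fun z hz => by
    by_contra h
    exact hz (hAB z h)
  -- the solved factorisation, for each of the three blocks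
  have hfac := twoSum_factor G hsymm A (insert c₁ (insert c₂ Aᶜ)) c₁ c₂ hρ hMarkov
  have hfacA : ∀ r ∈ A, ∀ q ∉ A, G r q
      = G r c₁ * ((G q c₁ - G c₁ c₂ * G q c₂) / (1 - G c₁ c₂ ^ 2))
        + G r c₂ * ((G q c₂ - G c₁ c₂ * G q c₁) / (1 - G c₁ c₂ ^ 2)) :=
    fun r hr q hq => hfac r q (Or.inl ⟨hr, hAB q hq⟩)
  have hfacB : ∀ r ∈ insert c₁ (insert c₂ Aᶜ), ∀ q ∉ insert c₁ (insert c₂ Aᶜ), G r q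
      = G r c₁ * ((G q c₁ - G c₁ c₂ * G q c₂) / (1 - G c₁ c₂ ^ 2))
        + G r c₂ * ((G q c₂ - G c₁ c₂ * G q c₁) / (1 - G c₁ c₂ ^ 2)) :=
    fun r hr q hq => hfac r q (Or.inr ⟨hr, hBA q hq⟩)
  have hfacS : ∀ r ∈ ({c₁, c₂} : Finset (Fin n)), ∀ q ∉ ({c₁, c₂} : Finset (Fin n)), G r q
      = G r c₁ * ((G q c₁ - G c₁ c₂ * G q c₂) / (1 - G c₁ c₂ ^ 2))
        + G r c₂ * ((G q c₂ - G c₁ c₂ * G q c₁) / (1 - G c₁ c₂ ^ 2)) := by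
    intro r hr q _
    by_cases hqA : q ∈ A
    · exact hfac r q (Or.inr ⟨hSB r hr, hqA⟩)
    · exact hfac r q (Or.inl ⟨hSA r hr, hAB q hqA⟩)
  -- the candidate inverse `M` and `M G = 1`
  obtain ⟨M, hM⟩ : ∃ M : Matrix (Fin n) (Fin n) ℝ, M = Matrix.of fun p q : Fin n =>
      (if h : p ∈ A ∧ q ∈ A then
          (G.submatrix (Subtype.val : ↥A → Fin n) (Subtype.val : ↥A → Fin n))⁻¹ ⟨p, h.1⟩ ⟨q, h.2⟩
        else 0)
      + (if h : p ∈ insert c₁ (insert c₂ Aᶜ) ∧ q ∈ insert c₁ (insert c₂ Aᶜ) then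
          (G.submatrix (Subtype.val : ↥(insert c₁ (insert c₂ Aᶜ)) → Fin n)
              (Subtype.val : ↥(insert c₁ (insert c₂ Aᶜ)) → Fin n))⁻¹ ⟨p, h.1⟩ ⟨q, h.2⟩
        else 0)
      - (if h : p ∈ ({c₁, c₂} : Finset (Fin n)) ∧ q ∈ ({c₁, c₂} : Finset (Fin n)) then
          (G.submatrix (Subtype.val : ↥({c₁, c₂} : Finset (Fin n)) → Fin n)
              (Subtype.val : ↥({c₁, c₂} : Finset (Fin n)) → Fin n))⁻¹ ⟨p, h.1⟩ ⟨q, h.2⟩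
        else 0) := ⟨_, rfl⟩
  have hMG : M * G = 1 := by
    ext p q
    rw [Matrix.mul_apply, hM]
    simp only [Matrix.of_apply, sub_mul, add_mul, Finset.sum_sub_distrib, Finset.sum_add_distrib]
    rw [twoSum_padded_mul G hPD A c₁ c₂ hc₁ hc₂ _ _ hfacA p q,
      twoSum_padded_mul G hPD (insert c₁ (insert c₂ Aᶜ)) c₁ c₂ hc₁B hc₂B _ _ hfacB p q,
      twoSum_padded_mul G hPD ({c₁, c₂} : Finset (Fin n)) c₁ c₂ hc₁S hc₂S _ _ hfacS p q,
      Matrix.one_apply]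
    by_cases hpS : p ∈ ({c₁, c₂} : Finset (Fin n))
    · have hpA : p ∈ A := hSA p hpS
      have hpB : p ∈ insert c₁ (insert c₂ Aᶜ) := hSB p hpS
      by_cases hqS : q ∈ ({c₁, c₂} : Finset (Fin n))
      · have hqA : q ∈ A := hSA q hqS
        have hqB : q ∈ insert c₁ (insert c₂ Aᶜ) := hSB q hqS
        simp [hpA, hpB, hpS, hqA, hqB, hqS]
      · by_cases hqA : q ∈ A
        · have hqB : q ∉ insert c₁ (insert c₂ Aᶜ) := fun h => by
            rcases (hmemB q).1 h with h | h | h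
            · exact hqS ((hmemS q).2 (Or.inl h))
            · exact hqS ((hmemS q).2 (Or.inr h))
            · exact h hqA
          simp [hpA, hpB, hpS, hqA, hqB, hqS]
        · have hqB : q ∈ insert c₁ (insert c₂ Aᶜ) := hAB q hqA
          simp [hpA, hpB, hpS, hqA, hqB, hqS]
    · have hpc₁ : p ≠ c₁ := fun h => hpS ((hmemS p).2 (Or.inl h))
      have hpc₂ : p ≠ c₂ := fun h => hpS ((hmemS p).2 (Or.inr h))
      by_cases hpA : p ∈ A
      · have hpB : p ∉ insert c₁ (insert c₂ Aᶜ) := fun h => by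
          rcases (hmemB p).1 h with h | h | h
          · exact hpc₁ h
          · exact hpc₂ h
          · exact h hpA
        by_cases hqA : q ∈ A
        · simp [hpA, hpB, hpS, hqA]
        · have hne : p ≠ q := fun h => hqA (h ▸ hpA)
          simp [hpA, hpB, hpS, hqA, hpc₁, hpc₂, hne]
      · have hpB : p ∈ insert c₁ (insert c₂ Aᶜ) := hAB p hpA
        by_cases hqB : q ∈ insert c₁ (insert c₂ Aᶜ)
        · simp [hpA, hpB, hpS, hqB]
        · have hne : p ≠ q := fun h => hqB (h ▸ hpB)
          simp [hpA, hpB, hpS, hqB, hpc₁, hpc₂, hne]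
  intro p q
  rw [Matrix.inv_eq_left_inv hMG, hM, Matrix.of_apply]

end Summit.CriticalPhenomena.Ising3DConformalLimit.Cruxes.InverseMFerromagnet.PartialCovarianceLadder
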